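import Mathlib.MeasureTheory.Measure.Portmanteau
import Mathlib.MeasureTheory.Integral.IntervalIntegral.Periodic
import Literature.NumberTheory.UniformDistribution.EquidistributedModOne
import Literature.NumberTheory.UniformDistribution.EquidistributedModOnePi
import HarnessLib

/-!
# Uniform distribution mod 1 as weak convergence of empirical measures; counting in sets with
# null boundary

Topic `Literature/NumberTheory/UniformDistribution`; proof sibling (theorems only — no definition of
`Prop` type, no named fact) of `EquidistributedModOne.lean` (Kuipers–Niederreiter 1974, Ch. 1,
Def. 1.1, Thm. 1.1, Thm. 2.1) and `EquidistributedModOnePi.lean` (Def. 6.1, Thms. 6.1–6.2).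

Kuipers–Niederreiter 1974, Ch. 3, §1 recasts uniform distribution as **weak convergence of the
empirical measures** `N⁻¹ ∑_{n<N} δ_{x_n}` to a Borel probability measure `μ` on a compact space
(Def. 1.1: `N⁻¹ ∑_{n≤N} f(x_n) → ∫ f dμ` for all continuous real `f`), and proves that this is
equivalent to `#{n ≤ N : x_n ∈ E}/N → μ(E)` for all `μ`-continuity sets `E` (`μ(∂E) = 0`). This
file supplies that dictionary for the tree's notions, through Mathlib's topology of weak
convergence on `ProbabilityMeasure` and its portmanteau theorem
(`ProbabilityMeasure.tendsto_measure_of_null_frontier_of_tendsto`):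

* `tendsto_empirical_of_forall_continuous` — on any topological measurable space: if
  `N⁻¹ ∑_{n<N} g(y_n) → ∫ g dμ` for every continuous real `g`, the empirical probability measures
  `(N+1)⁻¹ ∑_{n≤N} δ_{y_n}` tend to `μ`; `tendsto_card_filter_mem_div_of_null_frontier` — hence
  `#{n < N : y_n ∈ E}/N → μ(E)` for every measurable `E` with `μ(∂E) = 0`
  (Kuipers–Niederreiter Ch. 3, §1).
* On the circle `ℝ/ℤ` (Mathlib's `UnitAddCircle`, `volume` = Haar of mass `1`):
  `EquidistributedModOne.tendsto_avg_continuousMap` (`…_real`) — the `C(ℝ/ℤ, ℂ)` / `C(ℝ/ℤ, ℝ)`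
  packaging of Kuipers–Niederreiter Cor. 1.2 / Thm. 1.1, from the tree's
  `EquidistributedModOne.tendsto_avg_complex` / `….tendsto_fractAvg`;
  `EquidistributedModOne.tendsto_empirical`, `EquidistributedModOne.tendsto_card_filter_mem_div` —
  weak convergence to Haar measure and counting in `vol`-continuity sets of `ℝ/ℤ`.
* On the torus `(ℝ/ℤ)^ι` (`UnitAddTorus ι`): `EquidistributedModOnePi.tendsto_empirical`,
  `EquidistributedModOnePi.tendsto_card_filter_mem_div` — the same for u.d. mod 1 in `ℝ^ι`, from the
  tree's `tendsto_avg_continuousMap_real_of_weyl` (Thm. 6.1) and Weyl's criterion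
  `EquidistributedModOnePi.isLittleO_weylSumPi` (Thm. 6.2); e.g. for boxes, balls, polytopes mod 1.

## References

* L. Kuipers, H. Niederreiter, *Uniform distribution of sequences*, Wiley 1974: Ch. 1, Def. 1.1,
  Thm. 1.1, Cor. 1.2, §6 (Def. 6.1, Thm. 6.1); Ch. 3, §1 (Def. 1.1 and the equivalence with
  `μ`-continuity sets). [KuipersNiederreiter1974]
* P. Billingsley, *Convergence of probability measures*, 2nd ed., Wiley 1999, Thm. 2.1 (the
  portmanteau theorem) — Mathlib's `MeasureTheory.Measure.Portmanteau`. [folklore]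
-/

noncomputable section

open Filter Finset MeasureTheory BoundedContinuousFunction
open scoped Topology ENNReal NNReal

namespace Literature.NumberTheory.UniformDistribution

/-! ### Empirical measures on a topological measurable space -/

section Empirical

variable {Y : Type*} [MeasurableSpace Y]

/-- The empirical measure `(N+1)⁻¹ ∑_{n ≤ N} δ_{y_n}` of the first `N + 1` terms is a probability
measure. [folklore] -/
theorem isProbabilityMeasure_empirical (y : ℕ → Y) (N : ℕ) :
    IsProbabilityMeasure
      ((((N + 1 : ℕ) : ℝ≥0∞))⁻¹ • ∑ n ∈ Finset.range (N + 1), Measure.dirac (y n)) := by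
  refine ⟨?_⟩
  simp only [Measure.smul_apply, Measure.coe_finsetSum, Finset.sum_apply, measure_univ,
    Finset.sum_const, Finset.card_range, smul_eq_mul, nsmul_eq_mul, mul_one]
  exact ENNReal.inv_mul_cancel (by exact_mod_cast Nat.succ_ne_zero N) (ENNReal.natCast_ne_top _)

variable [TopologicalSpace Y] [OpensMeasurableSpace Y] [MeasurableSingletonClass Y]

/-- Integrals against the empirical measure are the averages `(N+1)⁻¹ ∑_{n ≤ N} f(y_n)`.
[folklore] -/
theorem integral_empirical (y : ℕ → Y) (N : ℕ) (f : Y →ᵇ ℝ) :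
    ∫ x, f x ∂((((N + 1 : ℕ) : ℝ≥0∞))⁻¹ • ∑ n ∈ Finset.range (N + 1), Measure.dirac (y n)) =
      (∑ n ∈ Finset.range (N + 1), f (y n)) / ((N + 1 : ℕ) : ℝ) := by
  rw [integral_smul_measure, integral_finsetSum_measure fun n _ => f.integrable _]
  simp_rw [integral_dirac]
  rw [ENNReal.toReal_inv, ENNReal.toReal_natCast, smul_eq_mul, inv_mul_eq_div]

/-- **Averages of continuous functions ⇒ weak convergence of the empirical measures**
(Kuipers–Niederreiter 1974, Ch. 3, §1, Def. 1.1, read in Mathlib's topology of weak convergence on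
`ProbabilityMeasure`): if `N⁻¹ ∑_{n<N} g(y_n) → ∫ g dμ` for every continuous real `g`, then the
empirical probability measures `(N+1)⁻¹ ∑_{n ≤ N} δ_{y_n}` tend to `μ`; consequently every
portmanteau conclusion of Mathlib applies. [cite: KuipersNiederreiter1974, Ch. 3 §1] -/
theorem tendsto_empirical_of_forall_continuous (μ : Measure Y) [IsProbabilityMeasure μ]
    {y : ℕ → Y}
    (hcont : ∀ g : C(Y, ℝ),
      Tendsto (fun N : ℕ => (∑ n ∈ Finset.range N, g (y n)) / N) atTop (𝓝 (∫ x, g x ∂μ))) :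
    Tendsto (β := ProbabilityMeasure Y) (fun N : ℕ =>
        ⟨(((N + 1 : ℕ) : ℝ≥0∞))⁻¹ • ∑ n ∈ Finset.range (N + 1), Measure.dirac (y n),
          isProbabilityMeasure_empirical y N⟩)
      atTop (𝓝 ⟨μ, inferInstance⟩) := by
  rw [ProbabilityMeasure.tendsto_iff_forall_integral_tendsto]
  intro f
  change Tendsto (fun N : ℕ => ∫ x, f x
      ∂((((N + 1 : ℕ) : ℝ≥0∞))⁻¹ • ∑ n ∈ Finset.range (N + 1), Measure.dirac (y n)))
    atTop (𝓝 (∫ x, f x ∂μ))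
  simp_rw [integral_empirical]
  exact (hcont f.toContinuousMap).comp (tendsto_add_atTop_nat 1)

/-- **Counting visits to a `μ`-continuity set** (portmanteau; Kuipers–Niederreiter 1974, Ch. 3,
§1: `μ`-uniform distribution in a compact space is equivalent to `lim A(E; N)/N = μ(E)` for all
`μ`-continuity sets `E`): under the same hypothesis, for every measurable `E` with `μ(∂E) = 0`,
`#{n < N : y_n ∈ E} / N → μ(E)`. [cite: KuipersNiederreiter1974, Ch. 3 §1] -/
theorem tendsto_card_filter_mem_div_of_null_frontier [HasOuterApproxClosed Y] (μ : Measure Y)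
    [IsProbabilityMeasure μ] {y : ℕ → Y}
    (hcont : ∀ g : C(Y, ℝ),
      Tendsto (fun N : ℕ => (∑ n ∈ Finset.range N, g (y n)) / N) atTop (𝓝 (∫ x, g x ∂μ)))
    {E : Set Y} [DecidablePred (· ∈ E)] (hE : MeasurableSet E) (hnull : μ (frontier E) = 0) :
    Tendsto (fun N : ℕ => (((Finset.range N).filter fun n => y n ∈ E).card : ℝ) / N) atTop
      (𝓝 (μ E).toReal) := by
  set μP : ProbabilityMeasure Y := ⟨μ, inferInstance⟩ with hμP
  set μs : ℕ → ProbabilityMeasure Y := fun N =>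
    ⟨(((N + 1 : ℕ) : ℝ≥0∞))⁻¹ • ∑ n ∈ Finset.range (N + 1), Measure.dirac (y n),
      isProbabilityMeasure_empirical y N⟩ with hμs
  have hlim : Tendsto μs atTop (𝓝 μP) := tendsto_empirical_of_forall_continuous μ hcont
  have hnull' : μP (frontier E) = 0 := (ProbabilityMeasure.null_iff_toMeasure_null _ _).2 hnull
  have key := (NNReal.continuous_coe.tendsto _).comp
    (ProbabilityMeasure.tendsto_measure_of_null_frontier_of_tendsto hlim hnull')
  -- identify the terms: `μ_N(E) = #{n ≤ N : y n ∈ E} / (N + 1)`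
  have hterm : ∀ N : ℕ, ((μs N E : ℝ≥0) : ℝ) =
      (((Finset.range (N + 1)).filter fun n => y n ∈ E).card : ℝ) / ((N + 1 : ℕ) : ℝ) := by
    intro N
    have hval : (μs N : Measure Y) =
        (((N + 1 : ℕ) : ℝ≥0∞))⁻¹ • ∑ n ∈ Finset.range (N + 1), Measure.dirac (y n) := rfl
    rw [ProbabilityMeasure.coeFn_def]
    dsimp only
    rw [hval]
    simp only [Measure.smul_apply, Measure.coe_finsetSum, Finset.sum_apply,
      Measure.dirac_apply' _ hE, smul_eq_mul, ENNReal.coe_toNNReal_eq_toReal]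
    have hind : ∀ n, E.indicator (1 : Y → ℝ≥0∞) (y n) = if y n ∈ E then 1 else 0 := fun n =>
      Set.indicator_apply E 1 (y n)
    simp_rw [hind]
    rw [Finset.sum_boole, ENNReal.toReal_mul, ENNReal.toReal_inv, ENNReal.toReal_natCast,
      ENNReal.toReal_natCast, inv_mul_eq_div]
  have hlimval : ((μP E : ℝ≥0) : ℝ) = (μ E).toReal := by
    have hval : (μP : Measure Y) = μ := rfl
    rw [ProbabilityMeasure.coeFn_def]
    dsimp only
    rw [hval, ENNReal.coe_toNNReal_eq_toReal]
  simp only [Function.comp_def, hterm, hlimval] at key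
  exact (tendsto_add_atTop_iff_nat (f := fun N : ℕ =>
    (((Finset.range N).filter fun n => y n ∈ E).card : ℝ) / N) 1).1 key

end Empirical

/-! ### The circle `ℝ/ℤ` -/

/-- The circle `ℝ/ℤ` with Mathlib's `volume` (the Haar measure of mass `1`) is a probability
space. [folklore] -/
theorem isProbabilityMeasure_volume_unitAddCircle :
    IsProbabilityMeasure (volume : Measure UnitAddCircle) :=
  ⟨UnitAddCircle.measure_univ⟩

attribute [local instance] isProbabilityMeasure_volume_unitAddCircle

/-- **Continuous test functions on `ℝ/ℤ`** (Kuipers–Niederreiter 1974, Ch. 1, Cor. 1.2: continuous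
`1`-periodic complex test functions), as functions on Mathlib's `UnitAddCircle`: if `u` is u.d. mod 1
then `N⁻¹ ∑_{n<N} F(u_n mod 1) → ∫_{ℝ/ℤ} F` for every `F : C(ℝ/ℤ, ℂ)` — the tree's
`EquidistributedModOne.tendsto_avg_complex` (test functions `f ∘ Int.fract`, `f` continuous on
`[0, 1]`) applied to `f = F ∘ (ℝ → ℝ/ℤ)`, with `∫₀¹ F(x mod 1) dx = ∫ F`
(`UnitAddCircle.intervalIntegral_preimage`). [cite: KuipersNiederreiter1974, Ch. 1 Cor. 1.2] -/
theorem EquidistributedModOne.tendsto_avg_continuousMap {u : ℕ → ℝ} (hu : EquidistributedModOne u)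
    (F : C(UnitAddCircle, ℂ)) :
    Tendsto (fun N : ℕ => (∑ n ∈ Finset.range N, F ((u n : ℝ) : UnitAddCircle)) / (N : ℂ)) atTop
      (𝓝 (∫ z : UnitAddCircle, F z)) := by
  have hf : ContinuousOn (fun x : ℝ => F ((x : ℝ) : UnitAddCircle)) (Set.Icc 0 1) :=
    (F.continuous.comp (AddCircle.continuous_mk' (1 : ℝ))).continuousOn
  have key := hu.tendsto_avg_complex hf
  simp only [coe_fract] at key
  rw [← UnitAddCircle.intervalIntegral_preimage 0, zero_add]
  exact key

/-- **Continuous real test functions on `ℝ/ℤ`** (Kuipers–Niederreiter 1974, Ch. 1, Thm. 1.1), as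
functions on `UnitAddCircle`: `N⁻¹ ∑_{n<N} F(u_n mod 1) → ∫ F` for `F : C(ℝ/ℤ, ℝ)` — the tree's
`EquidistributedModOne.tendsto_fractAvg` for `f = F ∘ (ℝ → ℝ/ℤ)`.
[cite: KuipersNiederreiter1974, Ch. 1 Thm. 1.1] -/
theorem EquidistributedModOne.tendsto_avg_continuousMap_real {u : ℕ → ℝ}
    (hu : EquidistributedModOne u) (F : C(UnitAddCircle, ℝ)) :
    Tendsto (fun N : ℕ => (∑ n ∈ Finset.range N, F ((u n : ℝ) : UnitAddCircle)) / (N : ℝ)) atTop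
      (𝓝 (∫ z : UnitAddCircle, F z)) := by
  have hf : ContinuousOn (fun x : ℝ => F ((x : ℝ) : UnitAddCircle)) (Set.Icc 0 1) :=
    (F.continuous.comp (AddCircle.continuous_mk' (1 : ℝ))).continuousOn
  have key := hu.tendsto_fractAvg hf
  simp only [fractAvg, coe_fract] at key
  rw [← UnitAddCircle.intervalIntegral_preimage 0, zero_add]
  exact key

/-- **Weak convergence of the empirical measures of a u.d. sequence** (Kuipers–Niederreiter 1974,
Ch. 3, §1: u.d. mod 1 is weak convergence to the Haar measure): if `u` is u.d. mod 1, the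
empirical probability measures of `(u_n mod 1)` tend to the Haar probability measure of `ℝ/ℤ` in
Mathlib's `ProbabilityMeasure` topology. [cite: KuipersNiederreiter1974, Ch. 3 §1] -/
theorem EquidistributedModOne.tendsto_empirical {u : ℕ → ℝ} (hu : EquidistributedModOne u) :
    Tendsto (β := ProbabilityMeasure UnitAddCircle) (fun N : ℕ =>
        ⟨(((N + 1 : ℕ) : ℝ≥0∞))⁻¹ • ∑ n ∈ Finset.range (N + 1),
            Measure.dirac (((u n : ℝ)) : UnitAddCircle),
          isProbabilityMeasure_empirical (fun n => ((u n : ℝ) : UnitAddCircle)) N⟩)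
      atTop (𝓝 ⟨volume, isProbabilityMeasure_volume_unitAddCircle⟩) :=
  tendsto_empirical_of_forall_continuous volume hu.tendsto_avg_continuousMap_real

/-- **Counting visits of `(u_n mod 1)` to a set with null boundary** (Kuipers–Niederreiter 1974,
Ch. 1, Def. 1.1 — the case of arcs `[a, b)` — in the generality of Ch. 3, §1, `vol`-continuity
sets): for u.d. `u` and measurable `E ⊆ ℝ/ℤ` with `vol(∂E) = 0`,
`#{n < N : u_n mod 1 ∈ E}/N → vol(E)`. [cite: KuipersNiederreiter1974, Ch. 3 §1] -/
theorem EquidistributedModOne.tendsto_card_filter_mem_div {u : ℕ → ℝ}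
    (hu : EquidistributedModOne u) {E : Set UnitAddCircle} [DecidablePred (· ∈ E)]
    (hE : MeasurableSet E) (hnull : volume (frontier E) = 0) :
    Tendsto (fun N : ℕ =>
        (((Finset.range N).filter fun n => ((u n : ℝ) : UnitAddCircle) ∈ E).card : ℝ) / N) atTop
      (𝓝 (volume E).toReal) :=
  tendsto_card_filter_mem_div_of_null_frontier volume (y := fun n => ((u n : ℝ) : UnitAddCircle))
    hu.tendsto_avg_continuousMap_real hE hnull

/-! ### The torus `(ℝ/ℤ)^ι` -/

section Torus

open Literature.NumberTheory.DiophantineApproximation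

variable {ι : Type*} [Fintype ι]

/-- **Weak convergence of the empirical measures on the torus**: if `x : ℕ → ℝ^ι` is u.d. mod 1
in `ℝ^ι` (Kuipers–Niederreiter 1974, Ch. 1, Def. 6.1), the empirical probability measures of
`(x_n mod ℤ^ι)` tend to the Haar probability measure of `(ℝ/ℤ)^ι` — from the tree's Thm. 6.1
(`tendsto_avg_continuousMap_real_of_weyl`) through Weyl's criterion (Thm. 6.2,
`EquidistributedModOnePi.isLittleO_weylSumPi`). [cite: KuipersNiederreiter1974, Ch. 3 §1] -/
theorem EquidistributedModOnePi.tendsto_empirical {x : ℕ → ι → ℝ}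
    (hx : EquidistributedModOnePi x) :
    Tendsto (β := ProbabilityMeasure (UnitAddTorus ι)) (fun N : ℕ =>
        ⟨(((N + 1 : ℕ) : ℝ≥0∞))⁻¹ • ∑ n ∈ Finset.range (N + 1),
            Measure.dirac (fun i => ((x n i : ℝ) : UnitAddCircle)),
          isProbabilityMeasure_empirical (fun n => fun i => ((x n i : ℝ) : UnitAddCircle)) N⟩)
      atTop (𝓝 ⟨volume, KroneckerWeyl.isProbabilityMeasure_volume_unitAddTorus⟩) := by
  have := KroneckerWeyl.isProbabilityMeasure_volume_unitAddTorus (ι := ι)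
  exact tendsto_empirical_of_forall_continuous volume
    (tendsto_avg_continuousMap_real_of_weyl fun _ hh => hx.isLittleO_weylSumPi hh)

/-- **Counting visits of `(x_n mod ℤ^ι)` to a set with null boundary** — the counting form of
u.d. mod 1 in `ℝ^ι` beyond boxes (Kuipers–Niederreiter 1974, Ch. 1, Def. 6.1 for boxes
`∏[a_i, b_i)`; Ch. 3, §1 for all `vol`-continuity sets: balls, polytopes, …): for u.d.
`x : ℕ → ℝ^ι` and measurable `E ⊆ (ℝ/ℤ)^ι` with `vol(∂E) = 0`,
`#{n < N : x_n mod ℤ^ι ∈ E}/N → vol(E)`. [cite: KuipersNiederreiter1974, Ch. 3 §1] -/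
theorem EquidistributedModOnePi.tendsto_card_filter_mem_div {x : ℕ → ι → ℝ}
    (hx : EquidistributedModOnePi x) {E : Set (UnitAddTorus ι)} [DecidablePred (· ∈ E)]
    (hE : MeasurableSet E) (hnull : volume (frontier E) = 0) :
    Tendsto (fun N : ℕ =>
        (((Finset.range N).filter fun n =>
          (fun i => ((x n i : ℝ) : UnitAddCircle)) ∈ E).card : ℝ) / N) atTop
      (𝓝 (volume E).toReal) := by
  have := KroneckerWeyl.isProbabilityMeasure_volume_unitAddTorus (ι := ι)
  exact tendsto_card_filter_mem_div_of_null_frontier volume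
    (y := fun n => fun i => ((x n i : ℝ) : UnitAddCircle))
    (tendsto_avg_continuousMap_real_of_weyl fun _ hh => hx.isLittleO_weylSumPi hh) hE hnull

end Torus

end Literature.NumberTheory.UniformDistribution

end
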